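import Summits.Ventures.CertifiedArithmetic.LowPrec.GemmWorstCaseE2M1Prec
import Summits.Ventures.CertifiedArithmetic.LowPrec.GemmDeficit
import Summits.Ventures.CertifiedArithmetic.LowPrec.AccumulateLangeRump
import Summits.Ventures.CertifiedArithmetic.LowPrec.AccumulateRange
import Summits.Ventures.CertifiedArithmetic.LowPrec.JRBridge
import HarnessLib

/-!
# GEMM worst case LXI-a — the FIRST REGIME of `W_p(n)` for E2M1² into every precision `p ≥ 8`:
# the exact range `n ≤ n₀(p)` and the Lange–Rump restart bound `W_p(n₀+k) ≤ ku/(1+ku)`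

HONEST FRAMING: certified error envelopes and provably optimal rounding/accumulation schemes for
low-precision formats under stated cost models; every table by two implementations; no hardware or
vendor claims.

`W_φ(n) = worstRelErrE2M1 φ (n-1)` (file L, `GemmWorstCaseE2M1Prec`) is the largest relative error of
sequential round-to-nearest-even accumulation in `φ` over all words of `n` letters of the product
alphabet `Π(E2M1,E2M1) ⊂ ¼ℤ ∩ [-36,36]`.  Write `T = 2^(manBits φ + 1)` (`= 4·2^{p-2}`: the binade
boundary `2^{p-2}` in quarter units) and let `j₀` be any number with `144·j₀ < T`; the largest such
`j₀` is `n₀(p) - 1`, `n₀(p) = ⌊(2^{p-2}-1)/36⌋ + 1` (`= 2, 15, 116509` for `p = 8, 11, 24`, the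
significand widths of bfloat16, binary16, binary32).  For every format `φ` with `7 ≤ manBits φ`,
`qexp φ ≤ -2`, `2^(manBits φ + 10) ≤ maxRat φ`
(the hypotheses of files XLIX/L; bfloat16 and binary32 meet them, binary16 does not — its row is the
kernel certificate of gemm.tex Prop. p:fp16):

* `seqSum_exact_prefix`, `worstP_eq_zero` — THE EXACT RANGE: every partial sum of at most `n₀`
  letters is computed exactly, so `W_φ(n) = 0` for `n ≤ n₀`: below `2^{p-2}` the quarter grid lies in
  `F_φ`, and a sum of `≤ n₀` letters that reaches `[2^{p-2}, 2^{p-1})` is a multiple of `½` — an odd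
  number of quarters needs a letter `¼, ¾, 9/4`, which leaves at most `144(n₀-1) + 9 < T` quarters
  (`KZ_shape`: a partial sum of `j+1` letters is even of size `≤ 144(j+1)`, or of size `≤ 144j+9`).
* `relErr_le_firstRegime`, `worstP_le_firstRegime` — THE RESTART BOUND: `W_φ(n₀+k) ≤ k/(T+k)`
  (`= ku/(1+ku)`, `u = 2^{-p}`) for `k ≤ 2^{p-1}`: from letter `n₀` on the computation is recursive
  summation of the `k+1` members `s_{n₀}, p_{n₀+1}, …, p_{n₀+k}` of `F_φ`, so Lange–Rump
  [BoldoEtAl2023, Thm 4.5] applies — here in the data-only range form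
  `abs_seqSum_sub_sum_le_langeRump_of_sum_le` (the lean seat's `abs_eval_sub_exact_le_langeRump` on
  the comb, range from `treeInRange_of_absSum_le`).
File LXI-b (`GemmFirstRegimeE2M1Law`) shows the bound is attained for `p ≢ 1, 2 (mod 6)` and gives the
binary32 law `W_24(n) = (n-116509)/(2^24+n-116509)`, `116510 ≤ n ≤ 8505117` (gemm.tex Prop. p:fpP).

Method: no `decide` over trajectories (the precision is a symbol): one `decide` over the 37 letters
(`letter_facts`), the quarter-grid bridge `exists_toRat_eq_quarter_prec` of file XLVIII and the
Jeannerod–Rump bridge `exists_toRat_eq_of_isFloat` for representability, file L's `W_φ`.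
References: [BoldoEtAl2023, Thm 4.5], [LangeRump2019] (restart bound; extremal input `(1,u,…,u)`);
[Higham2002, §4.2], [MullerEtAl2018HFPA, §6.1] (worst cases of recursive summation are format- and
data-specific); [RouhaniEtAl2023MX, Table 1] (E2M1); the exact first regime of a fixed product
alphabet in every precision is not in print to our knowledge (FRESHNESS-GEMM.md, gen 15 presearch).
-/

namespace Summit.Ventures.CertifiedArithmetic.LowPrec.Gemm

open Literature.ComputerArithmetic.FloatingPoint
open Literature.ComputerArithmetic.FloatingPoint.MiniFloat
open Literature.ComputerArithmetic.JeannerodRump2018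
open Literature.ComputerArithmetic.JeannerodRump2018.SumTree
open Finset

/-! ### Lange–Rump for `seqSum` with the range read off the data -/

/-- LANGE–RUMP, SEQUENTIAL FORM, DATA-ONLY RANGE: values `x 0 … x n` of `α` (`emaxCode ≥ 2`),
`(1 + n·u/(1+u))·Σ|xᵢ| ≤ maxRat` and `n ≤ ½u⁻¹` additions ⟹ `|ŝₙ - Σ xᵢ| ≤ nu/(1+nu)·Σ|xᵢ|`.
[cite: BoldoEtAl2023, Thm 4.5] -/
theorem abs_seqSum_sub_sum_le_langeRump_of_sum_le {α : Format} (hα : 2 ≤ α.emaxCode)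
    (x : ℕ → ℚ) (n : ℕ) (hx : ∀ i ≤ n, ∃ y : MiniFloat α, y.toRat = x i)
    (hsum : (1 + (n : ℚ) * (α.unitRoundoff / (1 + α.unitRoundoff)))
      * ∑ i ∈ range (n + 1), |x i| ≤ α.maxRat)
    (hn : 2 * (n : ℚ) * α.unitRoundoff ≤ 1) :
    |(seqSum α x n).toRat - ∑ i ∈ range (n + 1), x i|
      ≤ (n : ℚ) * α.unitRoundoff / (1 + (n : ℚ) * α.unitRoundoff) * ∑ i ∈ range (n + 1), |x i| := by
  have hlen : (((combTree x n).leaves.length : ℕ) : ℚ) - 1 = n := by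
    rw [length_leaves_combTree]; push_cast; ring
  have ht : TreeInRange α (combTree x n) :=
    treeInRange_of_absSum_le hα (combTree x n) (forall_leaves_combTree x _ n hx)
      (by rw [hlen, absSum_combTree]; exact hsum)
  have := abs_eval_sub_exact_le_langeRump hα (combTree x n) ht (by rw [hlen]; exact hn)
  rw [hlen, eval_combTree_eq_seqSum x (hx 0 (Nat.zero_le _)) n, exact_combTree,
    absSum_combTree] at this
  exact this

/-! ### The letters in quarter units -/

/-- Every letter `q` of `Π(E2M1,E2M1)` is `c/4` with `c ∈ ℤ`, `|c| ≤ 144`, and `c` odd only for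
`|c| ≤ 9` (the letters `¼, ¾, 9/4`). [cell; `piE2M1`] -/
theorem letter_facts : ∀ q ∈ piE2M1, (4 * q).den = 1 ∧ (4 * q).num.natAbs ≤ 144 ∧
    ((4 * q).num % 2 = 0 ∨ (4 * q).num.natAbs ≤ 9) := by
  decide +kernel

/-- `|q| ≤ 36` for every letter. [cell] -/
theorem abs_letter_le : ∀ q ∈ piE2M1, |q| ≤ 36 := by decide +kernel

/-- The quarter units `(4q).num` of a letter: `(4q).num = 4q`. [cell] -/
theorem num_cast {q : ℚ} (h : q ∈ piE2M1) : (((4 * q).num : ℤ) : ℚ) = 4 * q :=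
  Rat.coe_int_num_of_den_eq_one (letter_facts q h).1

/-- `q = (4q).num / 4`. [cell] -/
theorem eq_num_div {q : ℚ} (h : q ∈ piE2M1) : q = ((4 * q).num : ℚ) / 4 := by
  rw [num_cast h]; ring

variable {φ : Format}

/-- `emaxCode ≥ 2` follows from the range hypothesis. [folklore] -/
theorem two_le_emaxCode (hq : φ.qexp ≤ -2) (hR : (2 : ℚ) ^ (φ.manBits + 10) ≤ φ.maxRat) :
    2 ≤ φ.emaxCode := by
  by_contra h
  have h' : φ.emaxCode ≤ 1 := by omega
  have hms : φ.maxScaled < 2 ^ (φ.manBits + 1) := by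
    rcases Nat.lt_or_ge φ.emaxCode 1 with h0 | h1
    · rw [Format.maxScaled_eq_topMan (by omega)]
      exact lt_of_lt_of_le φ.topMan_lt (Nat.pow_le_pow_right (by norm_num) (by omega))
    · have h1' : φ.emaxCode = 1 := by omega
      have := Format.maxScaled_lt_pow (φ := φ) h1
      rwa [h1'] at this
  have hquant : φ.quantum ≤ 1 := by
    unfold Format.quantum
    calc (2 : ℚ) ^ φ.qexp ≤ 2 ^ (0 : ℤ) := zpow_le_zpow_right₀ (by norm_num) (by omega)
      _ = 1 := zpow_zero _
  have hlt : φ.maxRat < 2 ^ (φ.manBits + 1) := by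
    unfold Format.maxRat
    have hms' : (φ.maxScaled : ℚ) < 2 ^ (φ.manBits + 1) := by exact_mod_cast hms
    calc (φ.maxScaled : ℚ) * φ.quantum ≤ φ.maxScaled * 1 :=
          mul_le_mul_of_nonneg_left hquant (Nat.cast_nonneg _)
      _ < 2 ^ (φ.manBits + 1) := by rw [mul_one]; exact hms'
  have h2 : (2 : ℚ) ^ (φ.manBits + 1) ≤ 2 ^ (φ.manBits + 10) :=
    pow_le_pow_right₀ (by norm_num) (by omega)
  linarith

section Regime

variable (hm : 7 ≤ φ.manBits) (hq : φ.qexp ≤ -2) (hR : (2 : ℚ) ^ (φ.manBits + 10) ≤ φ.maxRat)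
include hm hq hR

omit hm in
/-- Quarter-grid values are values of `φ`: `K/4` with `|K| < T`, or `K` even with `|K| < 2T`
(`T = 2^(m+1)`). [folklore] -/
theorem quarter_repr {K : ℤ}
    (h : K.natAbs < 2 ^ (φ.manBits + 1) ∨ (K % 2 = 0 ∧ K.natAbs < 2 ^ (φ.manBits + 2))) :
    ∃ y : MiniFloat φ, y.toRat = (K : ℚ) / 4 := by
  have hR8 : (2 : ℚ) ^ (φ.manBits + 8) ≤ φ.maxRat :=
    le_trans (pow_le_pow_right₀ (by norm_num) (by omega)) hR
  have hT2 : 2 ^ (φ.manBits + 2) = 2 * 2 ^ (φ.manBits + 1) := by ring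
  have hKlt : K.natAbs < 2 ^ (φ.manBits + 10) := by
    have : 2 ^ (φ.manBits + 2) ≤ 2 ^ (φ.manBits + 10) :=
      Nat.pow_le_pow_right (by norm_num) (by omega)
    rcases h with h | ⟨_, h⟩ <;> omega
  have hrange := quarter_le_maxRat_of_lt hR8 hKlt
  rcases h with h | ⟨hev, hlt⟩
  · exact exists_toRat_eq_quarter_prec hq h hrange
  · obtain ⟨c, hc⟩ : ∃ c, K = 2 * c := ⟨K / 2, by omega⟩
    have hcabs : c.natAbs < 2 ^ (φ.manBits + 1) := by omega
    refine exists_toRat_eq_of_isFloat ⟨c, -1, ?_, by omega, ?_⟩ ?_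
    · rw [Int.abs_eq_natAbs]; exact_mod_cast hcabs
    · rw [hc, zpow_neg, zpow_one]; push_cast; ring
    · rw [abs_div, abs_of_pos (by norm_num : (0 : ℚ) < 4), ← Int.cast_abs, Int.abs_eq_natAbs,
        Int.cast_natCast]
      exact hrange

/-- Every letter is a value of `φ`. [cell] -/
theorem letter_repr {q : ℚ} (h : q ∈ piE2M1) : ∃ y : MiniFloat φ, y.toRat = q := by
  rw [eq_num_div h]
  refine quarter_repr hq hR (Or.inl ?_)
  have h1 := (letter_facts q h).2.1
  have h2 : 256 ≤ 2 ^ (φ.manBits + 1) :=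
    le_trans (by norm_num) (Nat.pow_le_pow_right (by norm_num) (by omega : 8 ≤ φ.manBits + 1))
  omega

/-! ### The exact range: every partial sum of at most `n₀` letters is exact -/

omit hm hq hR in
/-- `Σ_{i≤j} xᵢ = (Σ_{i≤j} (4xᵢ).num)/4`: the partial sum in quarter units. [cell] -/
theorem sum_eq_KZ {x : ℕ → ℚ} (hx : ∀ j, x j ∈ piE2M1) (j : ℕ) :
    ∑ i ∈ range (j + 1), x i = ((∑ i ∈ range (j + 1), (4 * x i).num : ℤ) : ℚ) / 4 := by
  push_cast; rw [div_eq_mul_inv, Finset.sum_mul]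
  exact sum_congr rfl (fun i _ => (eq_num_div (hx i)).trans (div_eq_mul_inv _ _))

omit hm hq hR in
/-- SHAPE OF A PARTIAL SUM of `j+1` letters in quarter units: even and of size `≤ 144(j+1)`, or (an
odd letter `¼, ¾, 9/4` was used) of size `≤ 144j + 9`. [cell, gemm.tex Prop. p:fpP (i)] -/
theorem KZ_shape {x : ℕ → ℚ} (hx : ∀ j, x j ∈ piE2M1) :
    ∀ j, ((∑ i ∈ range (j + 1), (4 * x i).num) % 2 = 0 ∧
        (∑ i ∈ range (j + 1), (4 * x i).num).natAbs ≤ 144 * (j + 1)) ∨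
      (∑ i ∈ range (j + 1), (4 * x i).num).natAbs ≤ 144 * j + 9
  | 0 => by
      have h := letter_facts _ (hx 0)
      simp only [zero_add, range_one, sum_singleton]
      omega
  | j + 1 => by
      have ih := KZ_shape hx j
      have h := letter_facts _ (hx (j + 1))
      rw [sum_range_succ _ (j + 1)]
      omega

/-- Every partial sum of at most `n₀` letters (`j ≤ j₀`, `144 j₀ < T`) is a value of `φ`. [cell] -/
theorem sum_repr {x : ℕ → ℚ} (hx : ∀ j, x j ∈ piE2M1) {j0 : ℕ}
    (hj0 : 144 * j0 < 2 ^ (φ.manBits + 1)) (j : ℕ) (hj : j ≤ j0) :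
    ∃ y : MiniFloat φ, y.toRat = ∑ i ∈ range (j + 1), x i := by
  rw [sum_eq_KZ hx]
  have h16 : 2 ^ (φ.manBits + 1) = 16 * 2 ^ (φ.manBits - 3) := by
    rw [show (16 : ℕ) = 2 ^ 4 by norm_num, ← pow_add]; congr 1; omega
  have he : 16 ≤ 2 ^ (φ.manBits - 3) :=
    le_trans (by norm_num) (Nat.pow_le_pow_right (by norm_num) (by omega : 4 ≤ φ.manBits - 3))
  have hT2 : 2 ^ (φ.manBits + 2) = 2 * 2 ^ (φ.manBits + 1) := by ring
  refine quarter_repr hq hR ?_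
  rcases KZ_shape hx j with ⟨hev, hle⟩ | hle
  · right; refine ⟨hev, ?_⟩
    have : 144 * (j + 1) ≤ 144 * j0 + 144 := by omega
    omega
  · left
    have : 144 * j + 9 ≤ 144 * j0 + 9 := by omega
    omega

/-- THE EXACT RANGE, every precision: `ŝ_j = s_j` for every word and every `j ≤ j₀` (`144 j₀ < T`),
i.e. every inner product of at most `n₀(p)` E2M1·E2M1 products accumulated sequentially in `φ` is
exact. [cell, gemm.tex Prop. p:fpP (i)] -/
theorem seqSum_exact_prefix {x : ℕ → ℚ} (hx : ∀ j, x j ∈ piE2M1) {j0 : ℕ}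
    (hj0 : 144 * j0 < 2 ^ (φ.manBits + 1)) :
    ∀ j ≤ j0, (seqSum φ x j).toRat = ∑ i ∈ range (j + 1), x i
  | 0, _ => by
      simp only [seqSum, zero_add, range_one, sum_singleton]
      have h := sum_repr hm hq hR hx hj0 0 (Nat.zero_le _)
      simp only [zero_add, range_one, sum_singleton] at h
      exact toRat_roundNE_of_exists h
  | j + 1, hj => by
      simp only [seqSum]
      rw [seqSum_exact_prefix hx hj0 j (by omega), ← sum_range_succ]
      exact toRat_roundNE_of_exists (sum_repr hm hq hR hx hj0 (j + 1) hj)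

/-- `W_φ(n) = 0` FOR `n ≤ n₀(p)` (index `m = n - 1` with `144 m < T`), every precision.
[cell, gemm.tex Prop. p:fpP (i)] -/
theorem worstP_eq_zero {m : ℕ} (h : 144 * m < 2 ^ (φ.manBits + 1)) : worstRelErrE2M1 φ m = 0 := by
  unfold worstRelErrE2M1
  refine le_antisymm (sup'_le _ _ fun w _ => ?_) ?_
  · unfold relErr
    rw [seqSum_exact_prefix hm hq hR (wordInput_mem w) h m le_rfl, sub_self, abs_zero, zero_div]
  · obtain ⟨w, hw⟩ := (univ_nonempty : (univ : Finset (Fin (m + 1) → Fin 37)).Nonempty)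
    refine le_trans ?_ (le_sup' (fun w => relErr φ (wordInput w) m) hw)
    unfold relErr; positivity

/-! ### The restart bound `W_φ(n₀ + k) ≤ k/(T + k)` -/

omit hm hq hR in
/-- Mass of letters: `Σ_{i<n} |xᵢ| ≤ 36 n`. [cell] -/
theorem sum_abs_le {x : ℕ → ℚ} (hx : ∀ j, x j ∈ piE2M1) (n : ℕ) :
    ∑ i ∈ range n, |x i| ≤ 36 * n :=
  calc ∑ i ∈ range n, |x i| ≤ ∑ _i ∈ range n, (36 : ℚ) := sum_le_sum fun i _ => abs_letter_le _ (hx i)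
    _ = 36 * n := by rw [sum_const, card_range, nsmul_eq_mul, mul_comm]

/-- THE RESTART BOUND, every precision: for every word and `k ≤ 2^manBits = ½u⁻¹`,
`R(x, n₀+k) ≤ k/(T+k)` (`= ku/(1+ku)`): after the exact prefix the computation is recursive summation
of `k+1` values of `φ`, and Lange–Rump applies. [cell, gemm.tex Prop. p:fpP (ii); BoldoEtAl2023 Thm 4.5] -/
theorem relErr_le_firstRegime {x : ℕ → ℚ} (hx : ∀ j, x j ∈ piE2M1) {j0 : ℕ}
    (hj0 : 144 * j0 < 2 ^ (φ.manBits + 1)) {k : ℕ} (hk : k ≤ 2 ^ φ.manBits) :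
    relErr φ x (j0 + k) ≤ (k : ℚ) / (2 ^ (φ.manBits + 1) + k) := by
  have hα := two_le_emaxCode hq hR
  set S := ∑ i ∈ range (j0 + 1), x i with hS
  set y : ℕ → ℚ := fun i => if i = 0 then S else x (j0 + i) with hy
  have hy0 : y 0 = S := by simp [hy]
  have hys : ∀ i, y (i + 1) = x (j0 + (i + 1)) := fun i => by simp [hy]
  -- the shifted accumulation
  have hstart : seqSum φ x j0 = roundNE φ S := by
    rcases Nat.eq_zero_or_pos j0 with h0 | hpos
    · subst h0; simp [seqSum, hS]
    · obtain ⟨j, rfl⟩ : ∃ j, j0 = j + 1 := ⟨j0 - 1, by omega⟩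
      simp only [seqSum]
      rw [seqSum_exact_prefix hm hq hR hx hj0 j (by omega), hS, sum_range_succ (fun i => x i) (j + 1)]
  have hshift : ∀ i, seqSum φ x (j0 + i) = seqSum φ y i := by
    intro i
    induction i with
    | zero => rw [Nat.add_zero, hstart]; simp [seqSum, hy0]
    | succ i ih =>
        show roundNE φ ((seqSum φ x (j0 + i)).toRat + x (j0 + i + 1)) =
          roundNE φ ((seqSum φ y i).toRat + y (i + 1))
        rw [ih, hys]
        rfl
  -- hypotheses of Lange–Rump for `y`
  have hSrep : ∃ z : MiniFloat φ, z.toRat = S := sum_repr hm hq hR hx hj0 j0 le_rfl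
  have hyrep : ∀ i ≤ k, ∃ z : MiniFloat φ, z.toRat = y i := by
    intro i _
    rcases i with _ | i
    · rw [hy0]; exact hSrep
    · rw [hys]; exact letter_repr hm hq hR (hx _)
  have hT : (2 : ℚ) ^ (φ.manBits + 1) = 2 * 2 ^ φ.manBits := by ring
  have hkq : (k : ℚ) ≤ 2 ^ φ.manBits := by exact_mod_cast hk
  have hj0q : (144 : ℚ) * j0 < 2 ^ (φ.manBits + 1) := by exact_mod_cast hj0
  have hu : φ.unitRoundoff = 1 / 2 ^ (φ.manBits + 1) := Format.unitRoundoff_eq φ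
  have hupos := φ.unitRoundoff_pos
  have h2pos : (0 : ℚ) < 2 ^ φ.manBits := by positivity
  have hku : 2 * (k : ℚ) * φ.unitRoundoff ≤ 1 := by
    rw [hu, hT]; field_simp; linarith
  -- masses
  have hmassy : ∑ i ∈ range (k + 1), |y i| ≤ ∑ i ∈ range (j0 + k + 1), |x i| := by
    have h1 : |S| ≤ ∑ i ∈ range (j0 + 1), |x i| := abs_sum_le_sum_abs _ _
    have h2 : ∑ i ∈ range k, |x (j0 + (i + 1))| = ∑ i ∈ range k, |x (j0 + 1 + i)| :=
      sum_congr rfl fun i _ => by rw [show j0 + (i + 1) = j0 + 1 + i by ring]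
    rw [sum_range_succ', hy0, show j0 + k + 1 = (j0 + 1) + k by ring,
      sum_range_add (fun i => |x i|) (j0 + 1) k]
    simp only [hys]
    linarith
  have hmassx := sum_abs_le hx (j0 + k + 1)
  have hsum : (1 + (k : ℚ) * (φ.unitRoundoff / (1 + φ.unitRoundoff)))
      * ∑ i ∈ range (k + 1), |y i| ≤ φ.maxRat := by
    have hfac : (k : ℚ) * (φ.unitRoundoff / (1 + φ.unitRoundoff)) ≤ 1 := by
      have h1 : φ.unitRoundoff / (1 + φ.unitRoundoff) ≤ φ.unitRoundoff :=
        div_le_self hupos.le (by linarith)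
      calc (k : ℚ) * (φ.unitRoundoff / (1 + φ.unitRoundoff)) ≤ k * φ.unitRoundoff :=
            mul_le_mul_of_nonneg_left h1 (Nat.cast_nonneg k)
        _ ≤ 1 := by linarith
    have hpos : 0 ≤ ∑ i ∈ range (k + 1), |y i| := sum_nonneg fun i _ => abs_nonneg _
    have hbig : 72 * ((j0 + k + 1 : ℕ) : ℚ) ≤ 2 ^ (φ.manBits + 10) := by
      have e10 : (2 : ℚ) ^ (φ.manBits + 10) = 1024 * 2 ^ φ.manBits := by ring
      have h1 : (1 : ℚ) ≤ 2 ^ φ.manBits := one_le_pow₀ (by norm_num)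
      rw [hT] at hj0q
      push_cast; rw [e10]; linarith
    calc (1 + (k : ℚ) * (φ.unitRoundoff / (1 + φ.unitRoundoff))) * ∑ i ∈ range (k + 1), |y i|
        ≤ 2 * ∑ i ∈ range (k + 1), |y i| := mul_le_mul_of_nonneg_right (by linarith) hpos
      _ ≤ φ.maxRat := by linarith
  have hLR := abs_seqSum_sub_sum_le_langeRump_of_sum_le hα y k hyrep hsum hku
  -- back to `x`
  have hsumy : ∑ i ∈ range (k + 1), y i = ∑ i ∈ range (j0 + k + 1), x i := by
    have h2 : ∑ i ∈ range k, x (j0 + (i + 1)) = ∑ i ∈ range k, x (j0 + 1 + i) :=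
      sum_congr rfl fun i _ => by rw [show j0 + (i + 1) = j0 + 1 + i by ring]
    rw [sum_range_succ', hy0, show j0 + k + 1 = (j0 + 1) + k by ring, sum_range_add x (j0 + 1) k,
      hS]
    simp only [hys]
    linarith
  have hcoef : (k : ℚ) * φ.unitRoundoff / (1 + (k : ℚ) * φ.unitRoundoff)
      = (k : ℚ) / (2 ^ (φ.manBits + 1) + k) := by
    rw [hu]; field_simp
  unfold relErr
  rw [hshift, ← hsumy]
  rw [hcoef] at hLR
  have hcnn : (0 : ℚ) ≤ (k : ℚ) / (2 ^ (φ.manBits + 1) + k) := by positivity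
  by_cases hL : ∑ i ∈ range (j0 + k + 1), |x i| = 0
  · rw [hL, div_zero]; exact hcnn
  · have hLpos : 0 < ∑ i ∈ range (j0 + k + 1), |x i| :=
      lt_of_le_of_ne (sum_nonneg fun i _ => abs_nonneg _) (Ne.symm hL)
    rw [div_le_iff₀ hLpos]
    exact le_trans hLR (mul_le_mul_of_nonneg_left hmassy hcnn)

/-- `W_φ(n₀ + k) ≤ k/(T + k)` for `k ≤ 2^manBits`, every precision. [cell, gemm.tex Prop. p:fpP (ii)] -/
theorem worstP_le_firstRegime {j0 : ℕ} (hj0 : 144 * j0 < 2 ^ (φ.manBits + 1)) {k : ℕ}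
    (hk : k ≤ 2 ^ φ.manBits) :
    worstRelErrE2M1 φ (j0 + k) ≤ (k : ℚ) / (2 ^ (φ.manBits + 1) + k) :=
  sup'_le _ _ fun w _ => relErr_le_firstRegime hm hq hR (wordInput_mem w) hj0 hk

end Regime

end Summit.Ventures.CertifiedArithmetic.LowPrec.Gemm
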